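import Summits.BirchSwinnertonDyer.BirchSwinnertonDyer.Theorems.AdditiveKolyvaginRoadRamifiedHabitatSignLawIZeroStar
import Literature.NumberTheory.DiophantineGeometry.ConductorMultiplicativeProofs
import HarnessLib

/-!
# Route `AdditiveKolyvaginRoad`, crux KS′ `LevelKolyvaginSystemsAdditive` (stmt-BirchSwinnertonDyer-21396), card `ramified-toric-habitat` —
# part 10 (LOCAL): the additive POTENTIALLY MULTIPLICATIVE row — the minimal model of `E^{(p*)}` at `p` is MULTIPLICATIVE, `N_{E^{(p*)}} = M p`

Cell `pub/bsd-wall`, width seat `bsd-wall-akr-p2x-w2` g11; `--supports stmt-BirchSwinnertonDyer-21396` (helper). THEOREMS ONLY; no definition,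
no named fact, no `sorry`. BSD is not proved by any of this; KS′/KPA′ stay OPEN at `p² ∣ N`.

The sketch's `RamifiedToricHabitat.SignLawPrincipalSeries` admits additive potentially multiplicative `p` (`semistabilityDefectAt = 2 ∣ p − 1`
by the reading in `SemistabilityDefect.lean`). Local data on that row (`p ≥ 5`, chosen `ℤ_p`-minimal model with `ord_p c₄ = 2`, `ord_p Δ = a > 6`):

* `addVal_minimal_pStarTwist_padic_of_addVal_c₄_lt` — the minimal model of `E^{(p*)}` by the `c₄`-criterion (`2 ≤ ord c₄ < 6`, `ord c₆ ≥ 3`,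
  `12 ≤ a + 6`, no upper bound on `a`): `ord_p Δ = a − 6`, `ord_p c₄ = ord_p c₄ − 2` (Silverman *AEC* VII.1 Remark 1.1 with `ord c₄ < 4`);
* `hasMultiplicativeReduction_pStarTwist_padic_of_potMult` — `E^{(p*)}` is MULTIPLICATIVE at `p` (`ord c₄ = 0`, `ord Δ = a − 6 > 0`), `E` additive with
  `3 ord c₄ < ord Δ`, and `W_p(E) = (−1/p)` (Rohrlich 1993 Prop. 2(iii), the tree's `localRootNumber`);
* `conductorNorm_pStarTwist_eq_mul_of_mult` — `N_{E^{(p*)}} = M·p` (`f_p = 1`).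

Part 11 (`…SignLawPotMult`) assembles `w(E)·w(E^{(d)}) = −(d'/p)·W_p(E^{(p*)})` from this.

References: [cite: Rohrlich1993Compositio, Prop. 2(iii)] [cite: SilvermanAEC2009, VII.1 Remark 1.1 and Prop. 1.3(b)] [cite: Silverman1994, IV.10.2].
-/

set_option autoImplicit false
set_option linter.dupNamespace false

noncomputable section

open scoped Classical MatrixGroups

open CongruenceSubgroup IsDedekindDomain IsDedekindDomain.HeightOneSpectrum NumberField Rat.HeightOneSpectrum
  WeierstrassCurve Literature.NumberTheory.EllipticCurves Literature.NumberTheory.EllipticCurves.ModularForms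
  IsDiscreteValuationRing

namespace Summit.BirchSwinnertonDyer.BirchSwinnertonDyer.Theorems.AdditiveKoly.RamifiedHabitat

/-! ## §12 The potentially MULTIPLICATIVE row: `E^{(p*)}` is multiplicative at `p` and the habitat sign DEPENDS on `d'` -/

section PotMult

open scoped NumberTheorySymbols

variable {p : ℕ} [Fact p.Prime]

/-- **Minimal model of `E^{(p*)}` at `p` by the `c₄`-criterion.** Let `X` be the chosen `ℤ_p`-minimal model of `E/ℚ_p` (`p ≥ 5`) with
`ord_p Δ(X) = a`, `12 ≤ a + 6`, `2 ≤ ord_p c₄(X) < 6`, `3 ≤ ord_p c₆(X)`. Then the `u = p` rescaling of the short normal form of `X^{(p*)}` is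
`p`-integral with `ord_p c₄ = ord_p c₄(X) − 2 < 4`, hence minimal (Silverman *AEC* VII.1 Remark 1.1), so the minimal model of `E^{(p*)}/ℚ_p` has
`ord_p Δ = a − 6` and `ord_p c₄ = ord_p c₄(X) − 2` — with no upper bound on `a` (the potentially multiplicative rows have `a = 6 + n`, any `n ≥ 1`).
[cite: SilvermanAEC2009, VII.1 Remark 1.1 and Prop. 1.3(b)] -/
theorem addVal_minimal_pStarTwist_padic_of_addVal_c₄_lt (W : WeierstrassCurve ℚ) [W.IsElliptic] (hp5 : 5 ≤ p) {a : ℕ}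
    (hΔ : addVal ℤ_[p] (((W.baseChange ℚ_[p]).minimal ℤ_[p]).integralModel ℤ_[p]).Δ = a) (ha : 12 ≤ a + 6)
    (hc₄ : (2 : ℕ∞) ≤ addVal ℤ_[p] (((W.baseChange ℚ_[p]).minimal ℤ_[p]).integralModel ℤ_[p]).c₄)
    (hc₄' : addVal ℤ_[p] (((W.baseChange ℚ_[p]).minimal ℤ_[p]).integralModel ℤ_[p]).c₄ < 6)
    (hc₆ : (3 : ℕ∞) ≤ addVal ℤ_[p] (((W.baseChange ℚ_[p]).minimal ℤ_[p]).integralModel ℤ_[p]).c₆) :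
    addVal ℤ_[p] ((((W.quadraticTwist (((-1 : ℤ) ^ (p / 2) * p : ℤ) : ℚ)).baseChange ℚ_[p]).minimal
        ℤ_[p]).integralModel ℤ_[p]).Δ = (a - 6 : ℕ) ∧
      addVal ℤ_[p] ((((W.quadraticTwist (((-1 : ℤ) ^ (p / 2) * p : ℤ) : ℚ)).baseChange ℚ_[p]).minimal
          ℤ_[p]).integralModel ℤ_[p]).c₄ + 2 =
        addVal ℤ_[p] (((W.baseChange ℚ_[p]).minimal ℤ_[p]).integralModel ℤ_[p]).c₄ := by
  have hvald := addVal_padicInt_pStar (p := p)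
  have hVd := valuation_padic_pStar (p := p)
  set d : ℤ := (-1 : ℤ) ^ (p / 2) * p with hd
  set V := (IsDiscreteValuationRing.maximalIdeal ℤ_[p]).valuation ℚ_[p] with hV
  have hp : p.Prime := Fact.out
  have hp2 : p ≠ 2 := by omega
  have hdZ0 : d ≠ 0 :=
    mul_ne_zero (pow_ne_zero _ (by norm_num)) (by exact_mod_cast hp.ne_zero)
  have hd0 : (d : ℚ) ≠ 0 := by exact_mod_cast hdZ0
  have hdK0 : (d : ℚ_[p]) ≠ 0 := by exact_mod_cast hdZ0
  have hdK : (d : ℚ_[p]) = algebraMap ℤ_[p] ℚ_[p] (d : ℤ_[p]) := by simp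
  have hp0 : (p : ℚ_[p]) ≠ 0 := by exact_mod_cast hp.ne_zero
  haveI : (W.quadraticTwist (d : ℚ)).IsElliptic := W.isElliptic_quadraticTwist hd0
  set Wp := W.baseChange ℚ_[p] with hWp
  set W'p := (W.quadraticTwist (d : ℚ)).baseChange ℚ_[p] with hW'p
  haveI : Wp.IsElliptic := by rw [hWp]; change (W.map _).IsElliptic; infer_instance
  haveI : W'p.IsElliptic := by rw [hW'p]; change ((W.quadraticTwist (d : ℚ)).map _).IsElliptic; infer_instance
  have htwK : W'p = Wp.quadraticTwist (d : ℚ_[p]) := by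
    rw [hW'p, hWp, baseChange, baseChange, map_quadraticTwist, map_intCast]
  set X := Wp.minimal ℤ_[p] with hX
  haveI : X.IsElliptic := by rw [hX]; unfold minimal; infer_instance
  obtain ⟨C, hC⟩ : ∃ C : VariableChange ℚ_[p], X = C • Wp := ⟨_, rfl⟩
  set I := X.integralModel ℤ_[p] with hI
  obtain ⟨A, hA⟩ := exists_eq_pow_mul_of_le_addVal hc₄
  obtain ⟨B, hB⟩ := exists_eq_pow_mul_of_le_addVal hc₆
  -- `ord c₄ = 2 + ord A`, `ord A < 4`
  have hvalp : addVal ℤ_[p] (p : ℤ_[p]) = (1 : ℕ) := by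
    rw [Nat.cast_one]; exact addVal_uniformizer PadicInt.irreducible_p
  have hAval : addVal ℤ_[p] I.c₄ = 2 + addVal ℤ_[p] A := by
    rw [hA, IsDiscreteValuationRing.addVal_mul, IsDiscreteValuationRing.addVal_pow, hvalp]; norm_num
  obtain ⟨cA, hcA⟩ : ∃ cA : ℕ, (cA : ℕ∞) = addVal ℤ_[p] A := by
    refine ENat.ne_top_iff_exists.mp fun htop ↦ ?_
    rw [hAval, htop, add_top] at hc₄'
    exact absurd hc₄' (by simp)
  have hcA4 : cA < 4 := by
    rw [hAval, ← hcA] at hc₄'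
    have : ((2 + cA : ℕ) : ℕ∞) < ((6 : ℕ) : ℕ∞) := by push_cast; exact hc₄'
    have := (show 2 + cA < 6 by exact_mod_cast this); omega
  set Y := X.quadraticTwist (d : ℚ_[p]) with hY
  haveI : Y.IsElliptic := X.isElliptic_quadraticTwist hdK0
  have hYc₄ : Y.c₄ = (d : ℚ_[p]) ^ 2 * ((p : ℚ_[p]) ^ 2 * (A : ℚ_[p])) := by
    rw [hY, quadraticTwist_c₄, ← integralModel_c₄_eq ℤ_[p] X, ← hI, hA]; simp
  have hYc₆ : Y.c₆ = (d : ℚ_[p]) ^ 3 * ((p : ℚ_[p]) ^ 3 * (B : ℚ_[p])) := by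
    rw [hY, quadraticTwist_c₆, ← integralModel_c₆_eq ℤ_[p] X, ← hI, hB]; simp
  letI : Invertible (2 : ℚ_[p]) := invertibleOfNonzero two_ne_zero
  letI : Invertible (3 : ℚ_[p]) := invertibleOfNonzero three_ne_zero
  set π : ℚ_[p]ˣ := Units.mk0 (p : ℚ_[p]) hp0 with hπ
  set E : VariableChange ℚ_[p] := ⟨π, 0, 0, 0⟩ * Y.toShortNF with hE
  have hTu : Y.toShortNF.u = 1 := by
    rw [WeierstrassCurve.toShortNF, VariableChange.mul_def]
    simp [WeierstrassCurve.toCharNeTwoNF]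
  have hEu : (E.u : ℚ_[p]) = p := by rw [hE, VariableChange.mul_def]; simp [hπ, hTu]
  set Z := E • Y with hZ
  have hs2 : ((d : ℚ_[p])) ^ 2 = (p : ℚ_[p]) ^ 2 := by
    rw [hd]; push_cast
    rw [mul_pow, ← pow_mul, Even.neg_one_pow ⟨p / 2, by ring⟩, one_mul]
  have hZeq : Z = ({ a₁ := 0, a₂ := 0, a₃ := 0, a₄ := -(A : ℚ_[p]) / 48,
                     a₆ := -((-1 : ℚ_[p]) ^ (p / 2) * (B : ℚ_[p])) / 864 } : WeierstrassCurve ℚ_[p]) := by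
    rw [hZ, hE, mul_smul, Y.toShortNF_smul_eq_of_c₄_c₆, scale_smul_short, hYc₄, hYc₆]
    congr 1
    · rw [hπ, Units.val_mk0, hs2]; field_simp
    · rw [hπ, Units.val_mk0, show ((d : ℚ_[p])) ^ 3 = (d : ℚ_[p]) ^ 2 * d by ring, hs2, hd]
      push_cast
      field_simp
  have hcop : ∀ m n : ℕ, p.Coprime (2 ^ m * 3 ^ n) := by
    intro m n
    rw [Nat.Prime.coprime_iff_not_dvd hp]
    intro h
    rcases (Nat.Prime.dvd_mul hp).mp h with h2 | h3
    · have := Nat.le_of_dvd (by norm_num) (hp.dvd_of_dvd_pow h2); omega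
    · have := Nat.le_of_dvd (by norm_num) (hp.dvd_of_dvd_pow h3); omega
  have h48 : ‖(48 : ℚ_[p])‖ = 1 := by
    rw [show (48 : ℚ_[p]) = ((2 ^ 4 * 3 ^ 1 : ℕ) : ℚ_[p]) by norm_num, Padic.norm_natCast_eq_one_iff]
    exact hcop 4 1
  have h864 : ‖(864 : ℚ_[p])‖ = 1 := by
    rw [show (864 : ℚ_[p]) = ((2 ^ 5 * 3 ^ 3 : ℕ) : ℚ_[p]) by norm_num, Padic.norm_natCast_eq_one_iff]
    exact hcop 5 3
  have n₄ : ‖-(A : ℚ_[p]) / 48‖ ≤ 1 := by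
    rw [norm_div, norm_neg, h48, div_one]; exact A.2
  have n₆ : ‖-((-1 : ℚ_[p]) ^ (p / 2) * (B : ℚ_[p])) / 864‖ ≤ 1 := by
    rw [norm_div, norm_neg, h864, div_one, norm_mul, norm_pow, norm_neg, norm_one, one_pow, one_mul]; exact B.2
  haveI hZint : Z.IsIntegral ℤ_[p] := by
    rw [hZeq]
    exact isIntegral_of_exists_lift _ ⟨0, by simp⟩ ⟨0, by simp⟩ ⟨0, by simp⟩
      (exists_padicInt_algebraMap_eq n₄) (exists_padicInt_algebraMap_eq n₆)
  have hVX : V X.Δ = WithZero.exp (-(a : ℤ)) := by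
    rw [← integralModel_Δ_eq ℤ_[p] X]
    exact valuation_algebraMap_eq_exp_neg_of_addVal_eq hΔ
  have hVp : V (p : ℚ_[p]) = WithZero.exp (-1 : ℤ) := by
    have := valuation_algebraMap_eq_exp_neg_of_addVal_eq (K := ℚ_[p]) hvalp
    simpa using this
  have hVd' : V (algebraMap ℤ_[p] ℚ_[p] (d : ℤ_[p])) = WithZero.exp (-1 : ℤ) := by rw [← hdK]; exact hVd
  have hEuinv : ((E.u⁻¹ : ℚ_[p]ˣ) : ℚ_[p]) = (p : ℚ_[p])⁻¹ := by rw [Units.val_inv_eq_inv_val, hEu]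
  have hVA : V (A : ℚ_[p]) = WithZero.exp (-(cA : ℤ)) :=
    valuation_algebraMap_eq_exp_neg_of_addVal_eq (K := ℚ_[p]) hcA.symm
  -- `Z` is minimal by the `c₄`-criterion: `c₄(Z) = A`, `ord A < 4`
  have hZc₄ : Z.c₄ = (A : ℚ_[p]) := by
    rw [hZ, variableChange_c₄, hEuinv, hYc₄, hs2]
    field_simp
  haveI hZmin : Z.IsMinimal ℤ_[p] := by
    refine isMinimal_of_exp_lt_valuation_c₄ Z ?_
    change WithZero.exp (-4 : ℤ) < V Z.c₄
    rw [hZc₄, hVA]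
    exact WithZero.exp_lt_exp.mpr (by omega)
  have hVZ : V Z.Δ = WithZero.exp (-((a - 6 : ℕ) : ℤ)) := by
    rw [hZ, variableChange_Δ, hEuinv, hY, quadraticTwist_Δ, Valuation.map_mul, Valuation.map_mul, Valuation.map_pow,
      Valuation.map_pow, map_inv₀, hVp, hVd, hVX, ← WithZero.exp_neg, ← WithZero.exp_nsmul, ← WithZero.exp_nsmul,
      ← WithZero.exp_add, ← WithZero.exp_add, Nat.cast_sub (by omega : 6 ≤ a)]
    congr 1
    simp only [nsmul_eq_mul, neg_neg]
    push_cast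
    ring
  obtain ⟨C', hC'⟩ : ∃ C' : VariableChange ℚ_[p], W'p.minimal ℤ_[p] = C' • W'p := ⟨_, rfl⟩
  have hYW : Y = ((⟨C.u, (d : ℚ_[p]) * C.r, 0, 0⟩ : VariableChange ℚ_[p])) • W'p := by
    rw [htwK, hY, hC, quadraticTwist_smul]
  have hrel : W'p.minimal ℤ_[p] =
      (C' * (E * ((⟨C.u, (d : ℚ_[p]) * C.r, 0, 0⟩ : VariableChange ℚ_[p])))⁻¹) • Z := by
    rw [mul_smul, hZ, hYW, ← mul_smul E, inv_smul_smul, ← hC']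
  have hZΔ0 : Z.Δ ≠ 0 := by
    intro h0
    have := hVZ
    rw [h0, Valuation.map_zero] at this
    exact WithZero.zero_ne_coe this
  refine ⟨?_, ?_⟩
  · rw [addVal_Δ_integralModel_eq_of_isMinimal_of_eq_smul ℤ_[p] hrel]
    have href : addVal ℤ_[p] ((d : ℤ_[p]) ^ (a - 6)) = ((a - 6 : ℕ) : ℕ∞) := by
      rw [IsDiscreteValuationRing.addVal_pow, hvald, nsmul_one]
    rw [← href]
    apply addVal_eq_addVal_of_valuation_algebraMap_eq ℤ_[p] (L := ℚ_[p])
    rw [integralModel_Δ_eq, map_pow, Valuation.map_pow, hVd', ← WithZero.exp_nsmul]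
    change V Z.Δ = _
    rw [hVZ]
    congr 1
    simp
  · rw [addVal_c₄_integralModel_eq_of_isMinimal_of_eq_smul ℤ_[p] hrel hZΔ0]
    have hZc₄' : (Z.integralModel ℤ_[p]).c₄ = A := by
      apply IsFractionRing.injective ℤ_[p] ℚ_[p]
      rw [integralModel_c₄_eq, hZc₄, show (algebraMap ℤ_[p] ℚ_[p]) A = (A : ℚ_[p]) from rfl]
    rw [hZc₄', hAval, add_comm]

/-- **POTENTIALLY MULTIPLICATIVE `p`: `E^{(p*)}` is MULTIPLICATIVE at `p`, `W_p(E) = (−1/p)`.** If the chosen `ℤ_p`-minimal model of `E/ℚ_p`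
(`p ≥ 5`) has `ord_p c₄ = 2` and `ord_p Δ = a > 6` (the additive potentially multiplicative rows: `ord_p j = 6 − a < 0`), then
`ord_p c₆ = 3`-ish (`≥ 3` from `c₄³ − c₆² = 1728Δ`), the minimal model of `E^{(p*)}` has `ord_p c₄ = 0`, `ord_p Δ = a − 6 > 0`
(MULTIPLICATIVE reduction), `E` is additive with `3 ord c₄ < ord Δ`, and Rohrlich's Prop. 2(iii) gives `W_p(E) = (−1/p)`.
[cite: Rohrlich1993Compositio, Prop. 2(iii)] [cite: SilvermanAEC2009, VII.1 Remark 1.1] -/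
theorem hasMultiplicativeReduction_pStarTwist_padic_of_potMult (W : WeierstrassCurve ℚ) [W.IsElliptic] (hp5 : 5 ≤ p) {a : ℕ}
    (hΔ : addVal ℤ_[p] (((W.baseChange ℚ_[p]).minimal ℤ_[p]).integralModel ℤ_[p]).Δ = a) (ha : 6 < a)
    (hc₄ : addVal ℤ_[p] (((W.baseChange ℚ_[p]).minimal ℤ_[p]).integralModel ℤ_[p]).c₄ = 2) :
    ((W.baseChange ℚ_[p]).minimal ℤ_[p]).HasAdditiveReduction ℤ_[p] ∧
      (((W.quadraticTwist (((-1 : ℤ) ^ (p / 2) * p : ℤ) : ℚ)).baseChange ℚ_[p]).minimal ℤ_[p]).HasMultiplicativeReduction ℤ_[p] ∧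
      (W.baseChange ℚ_[p]).localRootNumber ℤ_[p] = ZMod.χ₄ p := by
  set I := ((W.baseChange ℚ_[p]).minimal ℤ_[p]).integralModel ℤ_[p] with hI
  have hc₆ : (3 : ℕ∞) ≤ addVal ℤ_[p] I.c₆ := by
    have hrel : I.c₆ ^ 2 = I.c₄ ^ 3 - 1728 * I.Δ := by linear_combination I.c_relation
    have h1 : min (addVal ℤ_[p] (I.c₄ ^ 3)) (addVal ℤ_[p] (1728 * I.Δ)) ≤ addVal ℤ_[p] (I.c₆ ^ 2) := by
      rw [hrel]; exact AddValuation.map_sub _ _ _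
    rw [IsDiscreteValuationRing.addVal_pow, IsDiscreteValuationRing.addVal_pow, IsDiscreteValuationRing.addVal_mul, hΔ, hc₄] at h1
    have h6 : (6 : ℕ∞) ≤ min (3 • (2 : ℕ∞)) (addVal ℤ_[p] (1728 : ℤ_[p]) + (a : ℕ∞)) := by
      refine le_min (by norm_num) ?_
      calc (6 : ℕ∞) ≤ (a : ℕ∞) := by exact_mod_cast ha.le
        _ ≤ _ := le_add_self
    have h2 : (6 : ℕ∞) ≤ 2 • addVal ℤ_[p] I.c₆ := h6.trans h1
    by_cases htop : addVal ℤ_[p] I.c₆ = ⊤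
    · rw [htop]; exact le_top
    · obtain ⟨s, hs⟩ := ENat.ne_top_iff_exists.mp htop
      rw [← hs] at h2 ⊢
      have h3 : ((6 : ℕ) : ℕ∞) ≤ ((2 * s : ℕ) : ℕ∞) := by
        rw [Nat.cast_mul]; simpa [nsmul_eq_mul] using h2
      have h4 : 6 ≤ 2 * s := by exact_mod_cast h3
      exact_mod_cast (show 3 ≤ s by omega)
  obtain ⟨hΔ', hc₄'⟩ := addVal_minimal_pStarTwist_padic_of_addVal_c₄_lt W hp5 hΔ (by omega) (by rw [hc₄])
    (by rw [hc₄]; exact_mod_cast (show (2:ℕ) < 6 by norm_num)) hc₆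
  have ha0 : addVal ℤ_[p] I.Δ ≠ 0 := by rw [hΔ]; exact_mod_cast (show a ≠ 0 by omega)
  have hc0 : addVal ℤ_[p] I.c₄ ≠ 0 := by rw [hc₄]; norm_num
  have hadd := hasAdditiveReduction_minimal_padic_of_addVal (W.baseChange ℚ_[p]) ha0 hc0
  refine ⟨hadd, ?_, ?_⟩
  · set X' := ((W.quadraticTwist (((-1 : ℤ) ^ (p / 2) * p : ℤ) : ℚ)).baseChange ℚ_[p]).minimal ℤ_[p] with hX'
    rw [← hI, hc₄] at hc₄'
    have h0 : addVal ℤ_[p] (X'.integralModel ℤ_[p]).c₄ = 0 := by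
      have : addVal ℤ_[p] (X'.integralModel ℤ_[p]).c₄ + 2 = 0 + 2 := by rw [hc₄', zero_add]
      exact WithTop.add_right_cancel (by decide) this
    have hΔne : addVal ℤ_[p] (X'.integralModel ℤ_[p]).Δ ≠ 0 := by rw [hΔ']; exact_mod_cast (show a - 6 ≠ 0 by omega)
    have hV1 : (IsDiscreteValuationRing.maximalIdeal ℤ_[p]).valuation ℚ_[p] X'.c₄ = 1 := by
      rw [← integralModel_c₄_eq ℤ_[p] X']
      exact (addVal_eq_zero_iff_valuation_eq_one (K := ℚ_[p]) _).mp h0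
    have hV2 : (IsDiscreteValuationRing.maximalIdeal ℤ_[p]).valuation ℚ_[p] X'.Δ < 1 := by
      rw [← integralModel_Δ_eq ℤ_[p] X']
      exact (addVal_ne_zero_iff_valuation_lt_one (K := ℚ_[p]) _).mp hΔne
    exact ⟨hV2, hV1⟩
  · have hj : 3 * addVal ℤ_[p] I.c₄ < addVal ℤ_[p] I.Δ := by
      rw [hc₄, hΔ]; exact_mod_cast (show 3 * 2 < a by omega)
    rw [localRootNumber_padic_of_hasAdditiveReduction p _ hp5 hadd, if_pos hj]

/-- **`N_{E^{(p*)}}·p = N_E`** when `E` is additive and `E^{(p*)}` MULTIPLICATIVE at `p` (`f_p(E') = 1`; away from `p` the twist is by a unit).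
[cite: Silverman1994, IV.10.2 and IV.10.4] -/
theorem conductorNorm_pStarTwist_eq_mul_of_mult (W : WeierstrassCurve ℚ) [W.IsElliptic] (hp5 : 5 ≤ p)
    [(W.quadraticTwist (((-1 : ℤ) ^ (p / 2) * p : ℤ) : ℚ)).IsElliptic] {M : ℕ} (hN : W.conductorNorm ℤ = M * p ^ 2) (hpM : ¬ p ∣ M)
    (hmult : (((W.quadraticTwist (((-1 : ℤ) ^ (p / 2) * p : ℤ) : ℚ)).baseChange ℚ_[p]).minimal ℤ_[p]).HasMultiplicativeReduction ℤ_[p]) :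
    (W.quadraticTwist (((-1 : ℤ) ^ (p / 2) * p : ℤ) : ℚ)).conductorNorm ℤ = M * p := by
  have hp : p.Prime := Fact.out
  have hp2 : p ≠ 2 := by omega
  set N' := (W.quadraticTwist (((-1 : ℤ) ^ (p / 2) * p : ℤ) : ℚ)).conductorNorm ℤ with hN'
  have hN'0 : N' ≠ 0 := ((W.quadraticTwist _).conductorNorm_pos_holds).ne'
  have hM0 : M ≠ 0 := fun h ↦ (W.conductorNorm_pos_holds).ne' (by rw [hN, h, zero_mul])
  have hgen : ∀ q : Nat.Primes, natGenerator ((primesEquiv (R := ℤ)).symm q) = q := fun q ↦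
    congrArg (fun q : Nat.Primes ↦ (q : ℕ)) ((primesEquiv (R := ℤ)).apply_symm_apply q)
  refine Nat.eq_of_factorization_eq hN'0 (mul_ne_zero hM0 hp.ne_zero) fun q ↦ ?_
  by_cases hq : q.Prime
  swap
  · rw [Nat.factorization_eq_zero_of_not_prime _ hq, Nat.factorization_eq_zero_of_not_prime _ hq]
  set vq : HeightOneSpectrum ℤ := (primesEquiv (R := ℤ)).symm ⟨q, hq⟩ with hvq
  have hgenq : natGenerator vq = q := by rw [hvq]; exact hgen ⟨q, hq⟩
  by_cases hqp : q = p
  · subst hqp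
    have hmult' : (W.quadraticTwist (((-1 : ℤ) ^ (q / 2) * q : ℤ) : ℚ)).HasMultiplicativeReductionAt vq :=
      ((W.quadraticTwist _).hasMultiplicativeReductionAtPrime_iff_hasMultiplicativeReductionAt_holds ⟨q, hq⟩).mp hmult
    have h1 := ((conductorExponent_eq_one_iff_holds vq (W.quadraticTwist (((-1 : ℤ) ^ (q / 2) * q : ℤ) : ℚ))).mpr hmult')
    have hf := factorization_conductorNorm_holds (W.quadraticTwist (((-1 : ℤ) ^ (q / 2) * q : ℤ) : ℚ)) vq
    rw [hgenq] at hf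
    rw [hf, h1, Nat.factorization_mul hM0 hq.ne_zero, Finsupp.add_apply, hq.factorization, Finsupp.single_eq_same,
      Nat.factorization_eq_zero_of_not_dvd hpM]
  · have hqd : ¬ ((natGenerator vq : ℕ) : ℤ) ∣ (-1 : ℤ) ^ (p / 2) * p := by
      rw [hgenq]; exact fun h ↦ hqp (eq_of_prime_dvd_pStar hq h)
    have h := W.factorization_conductorNorm_quadraticTwist_eq_of_not_dvd (pStar_emod_four hp2) vq hqd
    rw [hgenq] at h
    rw [h, hN, Nat.factorization_mul hM0 (pow_ne_zero 2 hp.ne_zero), Nat.factorization_mul hM0 hp.ne_zero, Finsupp.add_apply,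
      Finsupp.add_apply, Nat.factorization_pow, Finsupp.smul_apply, hp.factorization, Finsupp.single_eq_of_ne hqp, smul_zero]


end PotMult

end Summit.BirchSwinnertonDyer.BirchSwinnertonDyer.Theorems.AdditiveKoly.RamifiedHabitat

end
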